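/-
Copyright (c) 2026 the pub-hodgecm-mathlib formalisation cell (harness21).  Prover seat hodgecm-mathlib-K2E3-p20 (g0),
Track B «K2-LIT» ∕ h413, line `K2_E3_EllipticInputs`, unit U5Kazhdan, socket #20P (DISC-PL) — rung (R-d): (DISC-PL)'s `d` IS the formal degree on the
supercuspidal classes (no junk freedom).  2026-09-03.
-/
import Summits.HodgeConjecture.HodgeConjecture.Theorems.K2E3FormalDegreeSupercuspidalWellDefined   -- ★ p855232 `exists_formalDegree_of_isSupercuspidal` (+ ★ E2-5a package)
import Summits.HodgeConjecture.HodgeConjecture.Theorems.F0P3cStCharTSScPseudoCoeff                   -- ★ E2-5b `isPseudoCoeff_scCoeff` (the sc coefficient is a pseudo-coefficient, hence CUSPIDAL)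
import Literature.NumberTheory.Rogawski1990.SupercuspidalNotSphericalCofinite                       -- ★ `IrrClass.isSquareIntegrable_of_isSupercuspidal_of_isCompact_center`
import HarnessLib

/-!
# K2_E3 road (h413 = stmt-HodgeConjecture-24833), socket #20P «DISC-PL» — rung (R-d): ANY `d` SATISFYING (DISC-PL) EQUALS THE CANONICAL FORMAL DEGREE
# ON THE SUPERCUSPIDAL CLASSES

Cell `pub/hodgecm-mathlib` (D-0151), Track B, line `Summits/HodgeConjecture/HodgeConjecture/Cruxes/H413/Lines/K2_E3_EllipticInputs.lean`, unit U5Kazhdan,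
socket #20P `sig_K2E3DiscretePlancherelCuspidal` (annex `…Sigs_U5bWildPlancherel.lean` :144; MEMO-20P-road 6ab33264ff32dae1 §4 (R-d)).  Helper file
(`--supports stmt-HodgeConjecture-24833 --as helper`, no socket closed); THEOREMS ONLY; `𝔇` a BINDER; ★-only imports.

THE POINT.  Socket #20P posits `∃ d > 0` with `f(1) = Σ_σ d(σ) Tr σ(f)` for every CUSPIDAL test function `f`.  The existential is not loose: on every class
possessing a cuspidal «trace-delta» function `g` (`Tr σ(g) = t·[σ = π]` on the `L²` classes, `t ≠ 0`) the series has one term and forces `d(π) = g(1) ∕ t`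
(§1, generic index sets).  The normalised SUPERCUSPIDAL coefficient `f_π` is such a function (★ E2-5a: `Tr π(f_π) = 1`, `Tr σ(f_π) = 0` for `σ ≠ π`; ★ E2-5b
`isPseudoCoeff_scCoeff`: it IS a pseudo-coefficient, hence cuspidal), so at the organ's datum every `d` satisfying (DISC-PL) has
`d(π) = f_π(1)` = THE canonical formal degree of ★ p855232 on EVERY supercuspidal class (§2) — the witness of #20P is pinned to Harish-Chandra's `d(π)`
there [HarishChandra1970, Part I §1 Thm 1; Rogawski1990 p. 194 «`f_π(1) = d(π)`»]; on `St_G(ψ)` the same argument with Kottwitz's EP function would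
pin `d` to the Euler–Poincaré value (not done here), on `π²(ξ)` a trace-delta cuspidal function is [K] Thm 4.1 (socket #17∕17W).
* §1 `formalDegree_eq_of_hasSum_traceDelta` (generic) · §2 **`discretePlancherel_pins_formalDegree_supercuspidal`**, **`discretePlancherel_eq_canonical_supercuspidal`**.
HONEST LABEL: count-neutral; HC_CM is proved only modulo the 7 printed citations (2 remaining named inputs: hLiu418 = stmt-HodgeConjecture-24832, h413 =
stmt-HodgeConjecture-24833) until rung 0 closes; this `--supports` helper retires nothing by itself.

## References
* [Rogawski1990] J. D. Rogawski, *Automorphic Representations of Unitary Groups in Three Variables*, Ann. of Math. Stud. 123 (1990), §12.6 p. 187; §12.7 p. 194.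
* [HarishChandra1970] Harish-Chandra (notes by G. van Dijk), *Harmonic Analysis on Reductive p-adic Groups*, LNM 162 (1970), Part I §1 Theorem 1.
-/

set_option autoImplicit false
-- the mandated namespace has the single-problem summit's repeated segment (`HodgeConjecture.HodgeConjecture`)
set_option linter.dupNamespace false

noncomputable section

open MeasureTheory NumberField IsDedekindDomain Filter Topology
open scoped ComplexConjugate
open Literature.NumberTheory.Automorphic Literature.NumberTheory.Automorphic.UnitaryGroup Literature.NumberTheory.Rogawski1990
open Literature.NumberTheory.Rogawski1990.Ch12Sec5
open Summit.HodgeConjecture.HodgeConjecture.Cruxes.H413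
open Summit.HodgeConjecture.HodgeConjecture.Cruxes.H413.F0P3cStCharTSTorusDefs

namespace Summit.HodgeConjecture.HodgeConjecture.Cruxes.H413.K2E3DiscretePlancherelPinsFormalDegree

/-! ## §1 A one-term Plancherel series pins its coefficient -/

open scoped Classical in
/-- **A trace-delta function pins `d`.**  If `HasSum (σ ↦ d(σ) · tr(σ)) s` over a subtype of classes containing `π`, and the traces are `tr(σ) = t·[σ = π]`
with `t ≠ 0`, then `d(π) · t = s`. [cite: Rogawski1990, §12.7 Lemma 12.7.2 (proof) p. 194] -/
theorem formalDegree_mul_eq_of_hasSum_traceDelta {C : Type*} {P : C → Prop} (d : C → ℝ) (tr : C → ℂ) {π : C} (hπ : P π) {t s : ℂ}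
    (htr : ∀ σ : C, P σ → tr σ = if σ = π then t else 0)
    (h : HasSum (fun σ : {σ : C // P σ} => ((d (σ : C) : ℝ) : ℂ) * tr (σ : C)) s) : ((d π : ℝ) : ℂ) * t = s := by
  have hF : (fun σ : {σ : C // P σ} => ((d (σ : C) : ℝ) : ℂ) * tr (σ : C)) =
      fun σ : {σ : C // P σ} => if σ = ⟨π, hπ⟩ then ((d π : ℝ) : ℂ) * t else 0 := by
    funext σ
    rw [htr σ σ.2]
    by_cases hσ : σ = ⟨π, hπ⟩
    · subst hσ; simp
    · have hσ' : (σ : C) ≠ π := fun e => hσ (Subtype.ext e)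
      rw [if_neg hσ', if_neg hσ, mul_zero]
  rw [hF] at h
  exact (hasSum_ite_eq _ _).unique h

/-! ## §2 At the organ's datum on `U(Φ₃)(L⁺_v)`: (DISC-PL)'s `d` is the formal degree on every supercuspidal class -/

section CM

variable (L : Type) [Field L] [NumberField L] [IsCMField L] (v : HeightOneSpectrum (𝓞 ↥(maximalRealSubfield L)))

set_option maxHeartbeats 1600000 in
set_option synthInstance.maxHeartbeats 400000 in
-- instance-term unification on the CM local carriers (as ★ ScPseudoCoeff)
/-- **(DISC-PL) PINS `d` ON THE SUPERCUSPIDAL CLASSES.**  At a §12.5 datum `𝔇` on `G = U(Φ₃)(L⁺_v)` (`v` non-split) with the rung-0 pins hC01 `hμG`, hC03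
`hμGZ`, hC04 `horb`, hC05 `hreg`, `hE`, `hchar` and a canonical orbital family (`hcanQ`): if `d : IrrClass G → ℝ` satisfies the consequent of socket #20P —
`HasSum (σ ↦ d(σ) · Tr σ(f)) (f(1))` over the `L²` classes for every cuspidal test function `f` — then for every SUPERCUSPIDAL class `π = ⟦r⟧`, every invariant
positive-definite Hermitian `B` on `r.V` and every `v₁ ≠ 0`: `d(π) = f_{r,B,v₁}(1)`, the value at `1` of the normalised coefficient (a pseudo-coefficient of
`π` by ★ E2-5b, hence cuspidal; `Tr σ(f_{r,B,v₁}) = [σ = π]` by ★ E2-5a). [cite: Rogawski1990, §12.7 Lemma 12.7.2 (proof) p. 194] [cite: HarishChandra1970, Part I §1 Theorem 1] -/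
theorem discretePlancherel_pins_formalDegree_supercuspidal
    (hns : ∀ w : PlacesOver L v, IsCMField.complexConj L • w.1 = w.1)
    [MeasurableSpace (Gqs L v)] [BorelSpace (Gqs L v)]
    [∀ γ : Gqs L v, MeasurableSpace (Gqs L v ⧸ Subgroup.centralizer ({γ} : Set (Gqs L v)))]
    [∀ γ : Gqs L v, BorelSpace (Gqs L v ⧸ Subgroup.centralizer ({γ} : Set (Gqs L v)))]
    [MeasurableSpace (Gqs L v ⧸ Subgroup.center (Gqs L v))] [BorelSpace (Gqs L v ⧸ Subgroup.center (Gqs L v))]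
    (μZ : Measure (Gqs L v ⧸ Subgroup.center (Gqs L v))) [μZ.IsHaarMeasure]
    {H : Type} [Group H] [TopologicalSpace H] [IsTopologicalGroup H] [MeasurableSpace H]
    (νQv : Measure (Gqs L v)) [νQv.IsHaarMeasure] [νQv.IsMulRightInvariant]
    (mQv : OrbitalMeasureFamily (Gqs L v))
    (hcanQ : mQv.IsCanonical (fun γ => IsRegularElt (γ.val : GL (Fin 3) (UnitaryGroup.LocalRing L v))) νQv)
    (𝔇 : EllipticData (Gqs L v) H)
    (hμG : 𝔇.μG = νQv) (hμGZ : 𝔇.μGZ = μZ) (horb : 𝔇.orb = mQv)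
    (hreg : ∀ γ : Gqs L v, γ ∈ 𝔇.regG ↔ IsRegularElt (γ.val : GL (Fin 3) (UnitaryGroup.LocalRing L v)))
    (hE : ∀ γ : Gqs L v, γ ∈ 𝔇.ellG ↔ IsRegularElt (γ.val : GL (Fin 3) (UnitaryGroup.LocalRing L v)) ∧ γ ∉ hyperbolicSet L v)
    (hM1 : ∀ π : IrrClass (Gqs L v), Measurable (𝔇.char π) ∧ LocallyIntegrable (𝔇.char π) 𝔇.μG ∧
      (∀ x ∈ 𝔇.regG, ∀ᶠ y in 𝓝 x, 𝔇.char π y = 𝔇.char π x) ∧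
      ∀ φ : Gqs L v → ℂ, IsLocSmooth φ → π.smoothTrace 𝔇.μG φ = ∫ x, φ x * 𝔇.char π x ∂𝔇.μG)
    (d : IrrClass (Gqs L v) → ℝ)
    (hPL : ∀ f : Gqs L v → ℂ, f ∈ SchwartzBruhat (Gqs L v) → (∀ γ ∈ 𝔇.regG \ 𝔇.ellG, 𝔇.orbInt γ f = 0) →
      HasSum (fun σ : {σ : IrrClass (Gqs L v) // 𝔇.IsL2 σ} => ((d (σ : IrrClass (Gqs L v)) : ℝ) : ℂ) *
        (σ : IrrClass (Gqs L v)).smoothTrace 𝔇.μG f) (f 1))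
    (r : SmoothIrrep (Gqs L v)) (hr : (IrrClass.mk r).IsSupercuspidal)
    (B : r.V →ₗ⋆[ℂ] r.V →ₗ[ℂ] ℂ) (hBsymm : B.IsSymm) (hBpos : ∀ w : r.V, w ≠ 0 → 0 < (B w w).re)
    (hBinv : ∀ (g : Gqs L v) (w w' : r.V), B (r.ρ g w) (r.ρ g w') = B w w') {v₁ : r.V} (hv₁ : v₁ ≠ 0) :
    ((d (IrrClass.mk r) : ℝ) : ℂ) =
      ((((∫ x, ‖B (r.ρ x v₁) v₁‖ ^ 2 ∂νQv) / (B v₁ v₁).re : ℝ) : ℂ)⁻¹ • fun g => B (r.ρ g v₁) v₁) 1 := by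
  classical
  -- the normalised coefficient is a pseudo-coefficient (cuspidal test function) with trace-delta traces
  have hpc := F0P3cStCharTSScPseudoCoeff.isPseudoCoeff_scCoeff L v hns νQv mQv hcanQ 𝔇 hμG horb hreg hE hM1 r hr B hBsymm hBpos hBinv hv₁
  have hsum := hPL _ hpc.1 hpc.2.1
  rw [hμG] at hsum
  have hL2 : 𝔇.IsL2 (IrrClass.mk r) := by
    show IrrClass.IsSquareIntegrable 𝔇.μGZ (IrrClass.mk r)
    rw [hμGZ]
    exact IrrClass.isSquareIntegrable_of_isSupercuspidal_of_isCompact_center μZ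
      (F0P3cStCharTSParField.isCompact_center_Gqs L v hns) _ hr
  have htr : ∀ σ : IrrClass (Gqs L v), 𝔇.IsL2 σ → σ.smoothTrace νQv
      ((((∫ x, ‖B (r.ρ x v₁) v₁‖ ^ 2 ∂νQv) / (B v₁ v₁).re : ℝ) : ℂ)⁻¹ • fun g => B (r.ρ g v₁) v₁) =
      if σ = IrrClass.mk r then 1 else 0 := by
    intro σ _
    split_ifs with h
    · subst h
      exact F0P3cStCharTSScTracePackage.smoothTrace_mk_scCoeff L v hns νQv r hr B hBsymm hBpos hBinv hv₁
    · exact F0P3cStCharTSScTracePackage.smoothTrace_scCoeff_eq_zero_of_ne L v hns νQv r hr B hBsymm hBpos hBinv v₁ σ h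
  have h := formalDegree_mul_eq_of_hasSum_traceDelta (P := fun σ : IrrClass (Gqs L v) => 𝔇.IsL2 σ) d _ hL2 htr hsum
  rwa [mul_one] at h

set_option maxHeartbeats 1600000 in
set_option synthInstance.maxHeartbeats 400000 in
-- instance-term unification on the CM local carriers
/-- **(DISC-PL)'S `d` = THE CANONICAL FORMAL DEGREE ON THE SUPERCUSPIDAL CLASSES.**  Under the same pins, any `d` satisfying socket #20P's consequent agrees
on every supercuspidal class `π` with the class-level formal degree of ★ p855232 `exists_formalDegree_of_isSupercuspidal` (the common value of
`(re B v v)² ∕ ∫ ‖B (r.ρ x v) v‖² dνQv` over all data of `π`): the existential of #20P carries no freedom there. [cite: HarishChandra1970, Part I §1 Theorem 1]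
[cite: Rogawski1990, §12.7 Lemma 12.7.2 (proof) p. 194] -/
theorem discretePlancherel_eq_canonical_supercuspidal
    (hns : ∀ w : PlacesOver L v, IsCMField.complexConj L • w.1 = w.1)
    [MeasurableSpace (Gqs L v)] [BorelSpace (Gqs L v)]
    [∀ γ : Gqs L v, MeasurableSpace (Gqs L v ⧸ Subgroup.centralizer ({γ} : Set (Gqs L v)))]
    [∀ γ : Gqs L v, BorelSpace (Gqs L v ⧸ Subgroup.centralizer ({γ} : Set (Gqs L v)))]
    [MeasurableSpace (Gqs L v ⧸ Subgroup.center (Gqs L v))] [BorelSpace (Gqs L v ⧸ Subgroup.center (Gqs L v))]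
    (μZ : Measure (Gqs L v ⧸ Subgroup.center (Gqs L v))) [μZ.IsHaarMeasure]
    {H : Type} [Group H] [TopologicalSpace H] [IsTopologicalGroup H] [MeasurableSpace H]
    (νQv : Measure (Gqs L v)) [νQv.IsHaarMeasure] [νQv.IsMulRightInvariant]
    (mQv : OrbitalMeasureFamily (Gqs L v))
    (hcanQ : mQv.IsCanonical (fun γ => IsRegularElt (γ.val : GL (Fin 3) (UnitaryGroup.LocalRing L v))) νQv)
    (𝔇 : EllipticData (Gqs L v) H)
    (hμG : 𝔇.μG = νQv) (hμGZ : 𝔇.μGZ = μZ) (horb : 𝔇.orb = mQv)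
    (hreg : ∀ γ : Gqs L v, γ ∈ 𝔇.regG ↔ IsRegularElt (γ.val : GL (Fin 3) (UnitaryGroup.LocalRing L v)))
    (hE : ∀ γ : Gqs L v, γ ∈ 𝔇.ellG ↔ IsRegularElt (γ.val : GL (Fin 3) (UnitaryGroup.LocalRing L v)) ∧ γ ∉ hyperbolicSet L v)
    (hM1 : ∀ π : IrrClass (Gqs L v), Measurable (𝔇.char π) ∧ LocallyIntegrable (𝔇.char π) 𝔇.μG ∧
      (∀ x ∈ 𝔇.regG, ∀ᶠ y in 𝓝 x, 𝔇.char π y = 𝔇.char π x) ∧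
      ∀ φ : Gqs L v → ℂ, IsLocSmooth φ → π.smoothTrace 𝔇.μG φ = ∫ x, φ x * 𝔇.char π x ∂𝔇.μG)
    (d : IrrClass (Gqs L v) → ℝ)
    (hPL : ∀ f : Gqs L v → ℂ, f ∈ SchwartzBruhat (Gqs L v) → (∀ γ ∈ 𝔇.regG \ 𝔇.ellG, 𝔇.orbInt γ f = 0) →
      HasSum (fun σ : {σ : IrrClass (Gqs L v) // 𝔇.IsL2 σ} => ((d (σ : IrrClass (Gqs L v)) : ℝ) : ℂ) *
        (σ : IrrClass (Gqs L v)).smoothTrace 𝔇.μG f) (f 1))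
    (π : IrrClass (Gqs L v)) (hπ : π.IsSupercuspidal) :
    ∃ dcan : ℝ, 0 < dcan ∧ d π = dcan ∧ ∀ (r : SmoothIrrep (Gqs L v)), IrrClass.mk r = π →
      ∀ (B : r.V →ₗ⋆[ℂ] r.V →ₗ[ℂ] ℂ), B.IsSymm → (∀ w : r.V, w ≠ 0 → 0 < (B w w).re) →
        (∀ (g : Gqs L v) (w w' : r.V), B (r.ρ g w) (r.ρ g w') = B w w') →
        ∀ v₁ : r.V, v₁ ≠ 0 → (B v₁ v₁).re ^ 2 / ∫ x, ‖B (r.ρ x v₁) v₁‖ ^ 2 ∂νQv = dcan := by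
  obtain ⟨dcan, hpos, hcan⟩ := K2E3FormalDegreeSupercuspidalWellDefined.exists_formalDegree_of_isSupercuspidal L v hns νQv π hπ
  refine ⟨dcan, hpos, ?_, fun r hr B hBsymm hBpos hBinv v₁ hv₁ => (hcan r hr B hBsymm hBpos hBinv v₁ hv₁).1⟩
  -- one datum of the class pins `d π`
  obtain ⟨r₀, rfl⟩ := IrrClass.mk_surjective π
  obtain ⟨B₀, hB₀symm, hB₀pos, hB₀inv⟩ := F0P3cStCharTSScTracePackage.exists_invariantForm_of_isSupercuspidal L v hns r₀ hπ
  haveI : Nontrivial r₀.V := Representation.IsIrreducible.nontrivial r₀.ρ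
  obtain ⟨v₀, hv₀⟩ := exists_ne (0 : r₀.V)
  have h1 := discretePlancherel_pins_formalDegree_supercuspidal L v hns μZ νQv mQv hcanQ 𝔇 hμG hμGZ horb hreg hE hM1 d hPL r₀ hπ B₀ hB₀symm hB₀pos
    hB₀inv hv₀
  rw [(hcan r₀ rfl B₀ hB₀symm hB₀pos hB₀inv v₀ hv₀).2] at h1
  exact_mod_cast h1

end CM

end Summit.HodgeConjecture.HodgeConjecture.Cruxes.H413.K2E3DiscretePlancherelPinsFormalDegree

end
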